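import Mathlib
import Summits.Ventures.PercRepro2.Defs
import Summits.Ventures.PercRepro2.Independence
import Summits.Ventures.PercRepro2.Harris
import Summits.Ventures.PercRepro2.ZCTwoEdge

/-!
# Theorem G (MINE-A.md §70.8) — the four cells of the two edges at `o`
(blind cell PercRepro2, mine-a g24)

Bookkeeping for `ZCA3W.lean`: with `e = {f₁ open} ∪ ({f₂ open} ∩ W)`, `L = A ∪ ({f₁, f₂ open} ∩ Γ)`,
`γ = ({f₁ open} ∩ A) ∪ ({f₂ open} ∩ Γ)`, `U = ({f₁, f₂ open} ∩ X₂) ∪ (e ∩ {f₁, f₂ open}ᶜ ∩ X₁) ∪ (eᶜ ∩ X₀)`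
and `A, W, Γ, X₀, X₁, X₂` ignoring `f₁`, `f₂`, the seven probabilities of (ZC) expand over the four
states of `(f₁, f₂)` (`prob_two_pin`) into probabilities of events of `G − a₃`:
`ow_prob_eL`, `ow_prob_enL`, `ow_prob_UeL`, `ow_prob_UenL`, `ow_prob_U`, `ow_prob_B`,
`ow_prob_D`.  One seat.
-/

namespace Summit.Ventures.PercRepro2

section Cells

variable {E : Type*} [Fintype E] [DecidableEq E] {R : Type*} [CommRing R]
  (p : E → R) {f₁ f₂ : E} (hf : f₁ ≠ f₂) {A W Γ X₀ X₁ X₂ : Set (Config E)}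
  (hA : ∀ (ω : Config E) (b₁ b₂ : Bool), Function.update (Function.update ω f₁ b₁) f₂ b₂ ∈ A ↔ ω ∈ A)
  (hW : ∀ (ω : Config E) (b₁ b₂ : Bool), Function.update (Function.update ω f₁ b₁) f₂ b₂ ∈ W ↔ ω ∈ W)
  (hΓ : ∀ (ω : Config E) (b₁ b₂ : Bool), Function.update (Function.update ω f₁ b₁) f₂ b₂ ∈ Γ ↔ ω ∈ Γ)
  (hX₀ : ∀ (ω : Config E) (b₁ b₂ : Bool), Function.update (Function.update ω f₁ b₁) f₂ b₂ ∈ X₀ ↔ ω ∈ X₀)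
  (hX₁ : ∀ (ω : Config E) (b₁ b₂ : Bool), Function.update (Function.update ω f₁ b₁) f₂ b₂ ∈ X₁ ↔ ω ∈ X₁)
  (hX₂ : ∀ (ω : Config E) (b₁ b₂ : Bool), Function.update (Function.update ω f₁ b₁) f₂ b₂ ∈ X₂ ↔ ω ∈ X₂)

include hf hA hW hΓ in
/-- The cell expansion of `P(e ∩ L)`. -/
lemma ow_prob_eL :
    prob p ((A ∪ (openEdge f₁ ∩ openEdge f₂ ∩ Γ)) ∩ (openEdge f₁ ∪ (openEdge f₂ ∩ W)))
      = p f₁ * p f₂ * prob p (A ∪ Γ) + p f₁ * (1 - p f₂) * prob p A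
        + (1 - p f₁) * p f₂ * prob p (A ∩ W) := by
  have hs1 := update2_fst hf
  rw [prob_two_pin p hf]
  have e11 : {ω | Function.update (Function.update ω f₁ true) f₂ true ∈
      (A ∪ (openEdge f₁ ∩ openEdge f₂ ∩ Γ)) ∩ (openEdge f₁ ∪ (openEdge f₂ ∩ W))} = A ∪ Γ := by
    ext ω; simp [hs1, hA, hW, hΓ]
  have e10 : {ω | Function.update (Function.update ω f₁ true) f₂ false ∈
      (A ∪ (openEdge f₁ ∩ openEdge f₂ ∩ Γ)) ∩ (openEdge f₁ ∪ (openEdge f₂ ∩ W))} = A := by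
    ext ω; simp [hs1, hA, hW, hΓ]
  have e01 : {ω | Function.update (Function.update ω f₁ false) f₂ true ∈
      (A ∪ (openEdge f₁ ∩ openEdge f₂ ∩ Γ)) ∩ (openEdge f₁ ∪ (openEdge f₂ ∩ W))} = A ∩ W := by
    ext ω; simp [hs1, hA, hW, hΓ]
  have e00 : {ω | Function.update (Function.update ω f₁ false) f₂ false ∈
      (A ∪ (openEdge f₁ ∩ openEdge f₂ ∩ Γ)) ∩ (openEdge f₁ ∪ (openEdge f₂ ∩ W))} = ∅ := by
    ext ω; simp [hs1, hA, hW, hΓ]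
  rw [e11, e10, e01, e00, prob_empty]; ring

include hf hA hW hΓ in
/-- The cell expansion of `P(e ∩ Lᶜ)`. -/
lemma ow_prob_enL :
    prob p ((A ∪ (openEdge f₁ ∩ openEdge f₂ ∩ Γ)) ∩ (openEdge f₁ ∪ (openEdge f₂ ∩ W))ᶜ)
      = (1 - p f₁) * p f₂ * prob p (A ∩ Wᶜ) + (1 - p f₁) * (1 - p f₂) * prob p A := by
  have hs1 := update2_fst hf
  rw [prob_two_pin p hf]
  have e11 : {ω | Function.update (Function.update ω f₁ true) f₂ true ∈
      (A ∪ (openEdge f₁ ∩ openEdge f₂ ∩ Γ)) ∩ (openEdge f₁ ∪ (openEdge f₂ ∩ W))ᶜ} = ∅ := by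
    ext ω; simp [hs1, hA, hW, hΓ]
  have e10 : {ω | Function.update (Function.update ω f₁ true) f₂ false ∈
      (A ∪ (openEdge f₁ ∩ openEdge f₂ ∩ Γ)) ∩ (openEdge f₁ ∪ (openEdge f₂ ∩ W))ᶜ} = ∅ := by
    ext ω; simp [hs1, hA, hW, hΓ]
  have e01 : {ω | Function.update (Function.update ω f₁ false) f₂ true ∈
      (A ∪ (openEdge f₁ ∩ openEdge f₂ ∩ Γ)) ∩ (openEdge f₁ ∪ (openEdge f₂ ∩ W))ᶜ} = A ∩ Wᶜ := by
    ext ω; simp [hs1, hA, hW, hΓ]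
  have e00 : {ω | Function.update (Function.update ω f₁ false) f₂ false ∈
      (A ∪ (openEdge f₁ ∩ openEdge f₂ ∩ Γ)) ∩ (openEdge f₁ ∪ (openEdge f₂ ∩ W))ᶜ} = A := by
    ext ω; simp [hs1, hA, hW, hΓ]
  rw [e11, e10, e01, e00, prob_empty]; ring

include hf hA hW hΓ hX₀ hX₁ hX₂ in
/-- The cell expansion of `P(U ∩ e ∩ L)`. -/
lemma ow_prob_UeL :
    prob p (((openEdge f₁ ∩ openEdge f₂ ∩ X₂)
        ∪ ((openEdge f₁ ∪ (openEdge f₂ ∩ W)) ∩ (openEdge f₁ ∩ openEdge f₂)ᶜ ∩ X₁)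
        ∪ ((openEdge f₁ ∪ (openEdge f₂ ∩ W))ᶜ ∩ X₀))
      ∩ ((A ∪ (openEdge f₁ ∩ openEdge f₂ ∩ Γ)) ∩ (openEdge f₁ ∪ (openEdge f₂ ∩ W))))
      = p f₁ * p f₂ * prob p (X₂ ∩ (A ∪ Γ)) + p f₁ * (1 - p f₂) * prob p (X₁ ∩ A)
        + (1 - p f₁) * p f₂ * prob p (X₁ ∩ (A ∩ W)) := by
  have hs1 := update2_fst hf
  rw [prob_two_pin p hf]
  have e11 : {ω | Function.update (Function.update ω f₁ true) f₂ true ∈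
      ((openEdge f₁ ∩ openEdge f₂ ∩ X₂)
        ∪ ((openEdge f₁ ∪ (openEdge f₂ ∩ W)) ∩ (openEdge f₁ ∩ openEdge f₂)ᶜ ∩ X₁)
        ∪ ((openEdge f₁ ∪ (openEdge f₂ ∩ W))ᶜ ∩ X₀))
      ∩ ((A ∪ (openEdge f₁ ∩ openEdge f₂ ∩ Γ)) ∩ (openEdge f₁ ∪ (openEdge f₂ ∩ W)))} = X₂ ∩ (A ∪ Γ) := by
    ext ω; simp [hs1, hA, hW, hΓ, hX₂]; tauto
  have e10 : {ω | Function.update (Function.update ω f₁ true) f₂ false ∈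
      ((openEdge f₁ ∩ openEdge f₂ ∩ X₂)
        ∪ ((openEdge f₁ ∪ (openEdge f₂ ∩ W)) ∩ (openEdge f₁ ∩ openEdge f₂)ᶜ ∩ X₁)
        ∪ ((openEdge f₁ ∪ (openEdge f₂ ∩ W))ᶜ ∩ X₀))
      ∩ ((A ∪ (openEdge f₁ ∩ openEdge f₂ ∩ Γ)) ∩ (openEdge f₁ ∪ (openEdge f₂ ∩ W)))} = X₁ ∩ A := by
    ext ω; simp [hs1, hA, hW, hΓ, hX₁]
  have e01 : {ω | Function.update (Function.update ω f₁ false) f₂ true ∈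
      ((openEdge f₁ ∩ openEdge f₂ ∩ X₂)
        ∪ ((openEdge f₁ ∪ (openEdge f₂ ∩ W)) ∩ (openEdge f₁ ∩ openEdge f₂)ᶜ ∩ X₁)
        ∪ ((openEdge f₁ ∪ (openEdge f₂ ∩ W))ᶜ ∩ X₀))
      ∩ ((A ∪ (openEdge f₁ ∩ openEdge f₂ ∩ Γ)) ∩ (openEdge f₁ ∪ (openEdge f₂ ∩ W)))} = X₁ ∩ (A ∩ W) := by
    ext ω; simp [hs1, hA, hW, hΓ, hX₁, hX₀]; tauto
  have e00 : {ω | Function.update (Function.update ω f₁ false) f₂ false ∈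
      ((openEdge f₁ ∩ openEdge f₂ ∩ X₂)
        ∪ ((openEdge f₁ ∪ (openEdge f₂ ∩ W)) ∩ (openEdge f₁ ∩ openEdge f₂)ᶜ ∩ X₁)
        ∪ ((openEdge f₁ ∪ (openEdge f₂ ∩ W))ᶜ ∩ X₀))
      ∩ ((A ∪ (openEdge f₁ ∩ openEdge f₂ ∩ Γ)) ∩ (openEdge f₁ ∪ (openEdge f₂ ∩ W)))} = ∅ := by
    ext ω; simp [hs1, hA, hW, hΓ]
  rw [e11, e10, e01, e00, prob_empty]; ring

include hf hA hW hΓ hX₀ hX₁ in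
/-- The cell expansion of `P(U ∩ e ∩ Lᶜ)`. -/
lemma ow_prob_UenL :
    prob p (((openEdge f₁ ∩ openEdge f₂ ∩ X₂)
        ∪ ((openEdge f₁ ∪ (openEdge f₂ ∩ W)) ∩ (openEdge f₁ ∩ openEdge f₂)ᶜ ∩ X₁)
        ∪ ((openEdge f₁ ∪ (openEdge f₂ ∩ W))ᶜ ∩ X₀))
      ∩ ((A ∪ (openEdge f₁ ∩ openEdge f₂ ∩ Γ)) ∩ (openEdge f₁ ∪ (openEdge f₂ ∩ W))ᶜ))
      = (1 - p f₁) * p f₂ * prob p (X₀ ∩ (A ∩ Wᶜ)) + (1 - p f₁) * (1 - p f₂) * prob p (X₀ ∩ A) := by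
  have hs1 := update2_fst hf
  rw [prob_two_pin p hf]
  have e11 : {ω | Function.update (Function.update ω f₁ true) f₂ true ∈
      ((openEdge f₁ ∩ openEdge f₂ ∩ X₂)
        ∪ ((openEdge f₁ ∪ (openEdge f₂ ∩ W)) ∩ (openEdge f₁ ∩ openEdge f₂)ᶜ ∩ X₁)
        ∪ ((openEdge f₁ ∪ (openEdge f₂ ∩ W))ᶜ ∩ X₀))
      ∩ ((A ∪ (openEdge f₁ ∩ openEdge f₂ ∩ Γ)) ∩ (openEdge f₁ ∪ (openEdge f₂ ∩ W))ᶜ)} = ∅ := by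
    ext ω; simp [hs1, hA, hW, hΓ]
  have e10 : {ω | Function.update (Function.update ω f₁ true) f₂ false ∈
      ((openEdge f₁ ∩ openEdge f₂ ∩ X₂)
        ∪ ((openEdge f₁ ∪ (openEdge f₂ ∩ W)) ∩ (openEdge f₁ ∩ openEdge f₂)ᶜ ∩ X₁)
        ∪ ((openEdge f₁ ∪ (openEdge f₂ ∩ W))ᶜ ∩ X₀))
      ∩ ((A ∪ (openEdge f₁ ∩ openEdge f₂ ∩ Γ)) ∩ (openEdge f₁ ∪ (openEdge f₂ ∩ W))ᶜ)} = ∅ := by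
    ext ω; simp [hs1, hA, hW, hΓ, hX₁]
  have e01 : {ω | Function.update (Function.update ω f₁ false) f₂ true ∈
      ((openEdge f₁ ∩ openEdge f₂ ∩ X₂)
        ∪ ((openEdge f₁ ∪ (openEdge f₂ ∩ W)) ∩ (openEdge f₁ ∩ openEdge f₂)ᶜ ∩ X₁)
        ∪ ((openEdge f₁ ∪ (openEdge f₂ ∩ W))ᶜ ∩ X₀))
      ∩ ((A ∪ (openEdge f₁ ∩ openEdge f₂ ∩ Γ)) ∩ (openEdge f₁ ∪ (openEdge f₂ ∩ W))ᶜ)} = X₀ ∩ (A ∩ Wᶜ) := by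
    ext ω; simp [hs1, hA, hW, hΓ, hX₁, hX₀]; tauto
  have e00 : {ω | Function.update (Function.update ω f₁ false) f₂ false ∈
      ((openEdge f₁ ∩ openEdge f₂ ∩ X₂)
        ∪ ((openEdge f₁ ∪ (openEdge f₂ ∩ W)) ∩ (openEdge f₁ ∩ openEdge f₂)ᶜ ∩ X₁)
        ∪ ((openEdge f₁ ∪ (openEdge f₂ ∩ W))ᶜ ∩ X₀))
      ∩ ((A ∪ (openEdge f₁ ∩ openEdge f₂ ∩ Γ)) ∩ (openEdge f₁ ∪ (openEdge f₂ ∩ W))ᶜ)} = X₀ ∩ A := by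
    ext ω; simp [hs1, hA, hW, hΓ, hX₀]
  rw [e11, e10, e01, e00, prob_empty]; ring

include hf hW hX₀ hX₁ hX₂ in
/-- The cell expansion of `P(U)`. -/
lemma ow_prob_U :
    prob p ((openEdge f₁ ∩ openEdge f₂ ∩ X₂)
        ∪ ((openEdge f₁ ∪ (openEdge f₂ ∩ W)) ∩ (openEdge f₁ ∩ openEdge f₂)ᶜ ∩ X₁)
        ∪ ((openEdge f₁ ∪ (openEdge f₂ ∩ W))ᶜ ∩ X₀))
      = p f₁ * p f₂ * prob p X₂ + p f₁ * (1 - p f₂) * prob p X₁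
        + (1 - p f₁) * p f₂ * prob p ((W ∩ X₁) ∪ (Wᶜ ∩ X₀)) + (1 - p f₁) * (1 - p f₂) * prob p X₀ := by
  have hs1 := update2_fst hf
  rw [prob_two_pin p hf]
  have e11 : {ω | Function.update (Function.update ω f₁ true) f₂ true ∈
      ((openEdge f₁ ∩ openEdge f₂ ∩ X₂)
        ∪ ((openEdge f₁ ∪ (openEdge f₂ ∩ W)) ∩ (openEdge f₁ ∩ openEdge f₂)ᶜ ∩ X₁)
        ∪ ((openEdge f₁ ∪ (openEdge f₂ ∩ W))ᶜ ∩ X₀))} = X₂ := by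
    ext ω; simp [hs1, hW, hX₂]
  have e10 : {ω | Function.update (Function.update ω f₁ true) f₂ false ∈
      ((openEdge f₁ ∩ openEdge f₂ ∩ X₂)
        ∪ ((openEdge f₁ ∪ (openEdge f₂ ∩ W)) ∩ (openEdge f₁ ∩ openEdge f₂)ᶜ ∩ X₁)
        ∪ ((openEdge f₁ ∪ (openEdge f₂ ∩ W))ᶜ ∩ X₀))} = X₁ := by
    ext ω; simp [hs1, hW, hX₁]
  have e01 : {ω | Function.update (Function.update ω f₁ false) f₂ true ∈
      ((openEdge f₁ ∩ openEdge f₂ ∩ X₂)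
        ∪ ((openEdge f₁ ∪ (openEdge f₂ ∩ W)) ∩ (openEdge f₁ ∩ openEdge f₂)ᶜ ∩ X₁)
        ∪ ((openEdge f₁ ∪ (openEdge f₂ ∩ W))ᶜ ∩ X₀))} = (W ∩ X₁) ∪ (Wᶜ ∩ X₀) := by
    ext ω; simp [hs1, hW, hX₁, hX₀]
  have e00 : {ω | Function.update (Function.update ω f₁ false) f₂ false ∈
      ((openEdge f₁ ∩ openEdge f₂ ∩ X₂)
        ∪ ((openEdge f₁ ∪ (openEdge f₂ ∩ W)) ∩ (openEdge f₁ ∩ openEdge f₂)ᶜ ∩ X₁)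
        ∪ ((openEdge f₁ ∪ (openEdge f₂ ∩ W))ᶜ ∩ X₀))} = X₀ := by
    ext ω; simp [hs1, hW, hX₀]
  rw [e11, e10, e01, e00]

include hf hA hW hΓ in
/-- The cell expansion of `P(B) = P(eᶜ ∩ Lᶜ ∩ γ)`. -/
lemma ow_prob_B :
    prob p ((A ∪ (openEdge f₁ ∩ openEdge f₂ ∩ Γ))ᶜ ∩ (openEdge f₁ ∪ (openEdge f₂ ∩ W))ᶜ
        ∩ ((openEdge f₁ ∩ A) ∪ (openEdge f₂ ∩ Γ)))
      = (1 - p f₁) * p f₂ * prob p (Aᶜ ∩ Wᶜ ∩ Γ) := by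
  have hs1 := update2_fst hf
  rw [prob_two_pin p hf]
  have e11 : {ω | Function.update (Function.update ω f₁ true) f₂ true ∈
      ((A ∪ (openEdge f₁ ∩ openEdge f₂ ∩ Γ))ᶜ ∩ (openEdge f₁ ∪ (openEdge f₂ ∩ W))ᶜ
        ∩ ((openEdge f₁ ∩ A) ∪ (openEdge f₂ ∩ Γ)))} = ∅ := by
    ext ω; simp [hs1]
  have e10 : {ω | Function.update (Function.update ω f₁ true) f₂ false ∈
      ((A ∪ (openEdge f₁ ∩ openEdge f₂ ∩ Γ))ᶜ ∩ (openEdge f₁ ∪ (openEdge f₂ ∩ W))ᶜ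
        ∩ ((openEdge f₁ ∩ A) ∪ (openEdge f₂ ∩ Γ)))} = ∅ := by
    ext ω; simp [hs1]
  have e01 : {ω | Function.update (Function.update ω f₁ false) f₂ true ∈
      ((A ∪ (openEdge f₁ ∩ openEdge f₂ ∩ Γ))ᶜ ∩ (openEdge f₁ ∪ (openEdge f₂ ∩ W))ᶜ
        ∩ ((openEdge f₁ ∩ A) ∪ (openEdge f₂ ∩ Γ)))} = Aᶜ ∩ Wᶜ ∩ Γ := by
    ext ω; simp [hs1, hA, hW, hΓ]
  have e00 : {ω | Function.update (Function.update ω f₁ false) f₂ false ∈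
      ((A ∪ (openEdge f₁ ∩ openEdge f₂ ∩ Γ))ᶜ ∩ (openEdge f₁ ∪ (openEdge f₂ ∩ W))ᶜ
        ∩ ((openEdge f₁ ∩ A) ∪ (openEdge f₂ ∩ Γ)))} = ∅ := by
    ext ω; simp [hs1]
  rw [e11, e10, e01, e00, prob_empty]; ring

include hf hA hW hΓ in
/-- The cell expansion of `P(D) = P(eᶜ ∩ Lᶜ ∩ γᶜ)`. -/
lemma ow_prob_D :
    prob p ((A ∪ (openEdge f₁ ∩ openEdge f₂ ∩ Γ))ᶜ ∩ (openEdge f₁ ∪ (openEdge f₂ ∩ W))ᶜ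
        ∩ ((openEdge f₁ ∩ A) ∪ (openEdge f₂ ∩ Γ))ᶜ)
      = (1 - p f₁) * p f₂ * prob p (Aᶜ ∩ Wᶜ ∩ Γᶜ) + (1 - p f₁) * (1 - p f₂) * prob p Aᶜ := by
  have hs1 := update2_fst hf
  rw [prob_two_pin p hf]
  have e11 : {ω | Function.update (Function.update ω f₁ true) f₂ true ∈
      ((A ∪ (openEdge f₁ ∩ openEdge f₂ ∩ Γ))ᶜ ∩ (openEdge f₁ ∪ (openEdge f₂ ∩ W))ᶜ
        ∩ ((openEdge f₁ ∩ A) ∪ (openEdge f₂ ∩ Γ))ᶜ)} = ∅ := by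
    ext ω; simp [hs1]
  have e10 : {ω | Function.update (Function.update ω f₁ true) f₂ false ∈
      ((A ∪ (openEdge f₁ ∩ openEdge f₂ ∩ Γ))ᶜ ∩ (openEdge f₁ ∪ (openEdge f₂ ∩ W))ᶜ
        ∩ ((openEdge f₁ ∩ A) ∪ (openEdge f₂ ∩ Γ))ᶜ)} = ∅ := by
    ext ω; simp [hs1]
  have e01 : {ω | Function.update (Function.update ω f₁ false) f₂ true ∈
      ((A ∪ (openEdge f₁ ∩ openEdge f₂ ∩ Γ))ᶜ ∩ (openEdge f₁ ∪ (openEdge f₂ ∩ W))ᶜ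
        ∩ ((openEdge f₁ ∩ A) ∪ (openEdge f₂ ∩ Γ))ᶜ)} = Aᶜ ∩ Wᶜ ∩ Γᶜ := by
    ext ω; simp [hs1, hA, hW, hΓ]
  have e00 : {ω | Function.update (Function.update ω f₁ false) f₂ false ∈
      ((A ∪ (openEdge f₁ ∩ openEdge f₂ ∩ Γ))ᶜ ∩ (openEdge f₁ ∪ (openEdge f₂ ∩ W))ᶜ
        ∩ ((openEdge f₁ ∩ A) ∪ (openEdge f₂ ∩ Γ))ᶜ)} = Aᶜ := by
    ext ω; simp [hs1, hA, hW, hΓ]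
  rw [e11, e10, e01, e00, prob_empty]; ring

end Cells

end Summit.Ventures.PercRepro2
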